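import Mathlib
import Literature.Combinatorics.Optimization.LPRelaxationsMaxCSP
import HarnessLib

/-!
# General LP relaxations of Max-CSPs are no stronger than Sherali–Adams
# (Chan–Lee–Raghavendra–Steurer 2013/2016, §3: Theorems 3.1 and 3.2), TYPED

Source: S. O. Chan, J. R. Lee, P. Raghavendra, D. Steurer, *Approximate constraint satisfaction
requires large LP relaxations*, FOCS 2013 / J. ACM 63 (4) (2016) Art. 34 [ChanEtAl2016]; held text
`paper:arxiv-1309.0563` = arXiv v3 (2016-02-08, the latest; numbers "Thm 3.1", "Thm 3.2",
"Lemma 3.3", "Lemma 3.5" and pages "p. N" are those of that rendering).  Vocabulary: the Boolean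
Max-CSP / LP-relaxation / Sherali–Adams model of `SDPRelaxationsMaxCSP.lean` and
`LPRelaxationsMaxCSP.lean` (`CSPInstance k n 𝒫` — constraints = predicates of the finite family `𝒫`
applied to DISTINCT variables, exactly the [CLRS13] framework of §2 p. 6 —, `LPRelaxation k n 𝒫 R`
with `LPRelaxation.Achieves c s` = "(c,s)-approximation" (§2 p. 6), `SAPseudoexpectation n d` =
"d-local expectation functional" (§2.1 p. 8) and `SAAchieves 𝒫 d c s` = "the d-round Sherali–Adams
relaxation achieves a (c,s)-approximation for Π_n", whose negation is "cannot achieve": some instance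
`ℑ` with `opt(ℑ) ≤ s` and some d-ℓ.e.f. `Ẽ` with `Ẽ[ℑ] > c`).

## Printed statements (verbatim up to notation) and how they are rendered

* **Theorem 3.1 (Main)** (p. 9): "Fix a positive number `d ∈ ℕ`, and a sequence of `k`-ary CSPs
  `{Π_n}`, with `k ≤ d`.  Suppose that the `d`-round Sherali–Adams relaxation cannot achieve a
  `(c,s)`-approximation for `Π_n` for every `n`.  Then no sequence of LP relaxations of size at most
  `n^{d/2}` can achieve a `(c,s)`-approximation for `Π_n` for every `n`."
  — `ChanEtAl2016_thm31`.  RENDERING (recorded, not a change of content): the proof (§3.3,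
  p. 10–11) uses ONE instance `ℑ₀ ∈ Π_m` on which `d` rounds of Sherali–Adams fail and shows that for
  all sufficiently large `n` (depending on `m`, `d` and the gap `SA_d(ℑ₀) − c`) no LP relaxation of
  size `≤ n^{d/2}` for `Π_n` is a `(c,s)`-approximation ("`𝓛(ℑ_S) ≥ SA_d(ℑ₀) − η_n` with `η_n → 0`").
  The fact is typed in exactly that form — hypothesis for one `m`, conclusion for all `n ≥ n₀` —
  which implies the printed sentence under every reading of its two "for every `n`".
* **Theorem 3.2** (p. 9): "Consider a function `f : ℕ → ℕ`.  Suppose that the `f(n)`-round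
  Sherali–Adams relaxation cannot achieve a `(c, s)`-approximation for `Π_n`.  Then for all
  sufficiently large `n`, no LP relaxation of size at most `n^{f(n)^2}` can achieve a
  `(c, s)`-approximation for `Π_N`, where `N ≤ n^{10 f(n)}`."  (p. 9: "In particular, by choosing
  `f(n) ≍ n^ε` …, known Sherali–Adams gaps … imply the same integrality gaps for LPs of size
  `n^{o(log n / log log n)}`"; proof p. 11: "Fix an instance size `m` and put `d = f(m)` … require
  that `n` grows like `m^{10d}` so that `η_n = o(1)` … The lower bound achieved is
  `n^{d/2} ≥ m^{5 f(m)^2}`.")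
  — `ChanEtAl2016_thm32`.  RENDERING (recorded): (i) the guards `1 ≤ f(n)` ("positive number `d`")
  and `k ≤ f(n)` (the `d`-ℓ.e.f. is applied to `ℑ`, a polynomial of degree `k`; `SA_d(ℑ)` is only
  defined for `d ≥ k`, cf. the guard of `KothariMekaRaghavendra2017_thm12`); (ii) the hypothesis is
  read with a margin `δ > 0` that does not depend on `n` — "cannot achieve a `(c + δ, s)`-
  approximation for `Π_n`, all large `n`" — and the conclusion is for `(c, s)`: the printed proof
  bounds the LP value below by `SA_{f(n)}(ℑ_n) − η_N` with an explicit `η_N → 0` (eq. (3.3)/(eq:eta),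
  p. 10–11) and needs the Sherali–Adams gap to dominate `η_N`; the sentence as printed does not
  quantify this dependence (compare the recorded caveat `(c − 1/n, s)` of
  `KothariMekaRaghavendra2017_thm12`, whose printed proof has the same shape).  Every Sherali–Adams gap
  the paper feeds in (p. 9: [CMM09] Max Cut, [Schoenebeck08] Max 3-Sat; tree:
  `Schoenebeck2008_maxKSatSA`, `Schoenebeck2008_maxKXorSA`, `Schoenebeck2008_parityImplied_SA`) has
  this uniform form (value `1` versus completeness `1 − ε`).

Both facts are `def … : Prop` (D-0014), NOT proved in this file; the proof (§3.1 entropy form of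
Chang's lemma [IMR14], §3.2 random restriction, §3.3) is the business of the sibling modules
`ChangInequalityDensities`, `SheraliAdamsRandomRestriction`, `LpRelaxationsVersusSheraliAdamsProof`
(in preparation by the same seat).  PROVED here (trivial, used by every consumer): more rounds of
Sherali–Adams achieve at least as much (`SAPseudoexpectation.ofLE`, `SAAchieves.of_le`,
`not_saAchieves_of_le`), and the conditional headline corollary `ChanEtAl2016_thm31.poly_of_linearSAGap`:
under Thm 3.1, a linear-round Sherali–Adams `(1 − ε, s₀ + ε)`-gap (the tree's PROVED Schoenebeck
theorems have exactly this shape) forbids `(1 − ε, s₀ + ε)`-approximation by LP relaxations of size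
`n^{d/2}`, for every `d` and all large `n` — "polynomial-sized LPs are exactly as powerful as programs
arising from O(1) rounds of the Sherali–Adams hierarchy" (abstract, p. 1).

Not typed: Thm 2.3 (both directions of the LP characterisation; "⇒" is the tree's
`LPRelaxation.Achieves.hasNonnegFactorization`), Lemma 2.4, §3.4 (smooth nonnegative rank remark),
§3.5 (non-Boolean alphabets), Thm 4.1 (symmetric LPs, via Yannakakis' Lemma 4.3).
-/

noncomputable section

open Finset

namespace Literature.Combinatorics.Optimization

/-! ### Round monotonicity of Sherali–Adams (proved) -/

namespace SAPseudoexpectation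

variable {n d D : ℕ}

/-- A degree-`D` Sherali–Adams pseudoexpectation is a degree-`d` one for `d ≤ D` (a nonnegative
`d`-junta is a nonnegative `D`-junta). [cite: ChanEtAl2016, §2.1 (arXiv v3 p. 8: "d-local expectation functional")] -/
def ofLE (pE : SAPseudoexpectation n D) (h : d ≤ D) : SAPseudoexpectation n d where
  E := pE.E
  nonneg p hp hp0 := pE.nonneg p (hp.mono h) hp0
  map_one := pE.map_one

/-- `ofLE` does not change the functional. [cite: ChanEtAl2016, §2.1 (arXiv v3 p. 8)] -/
@[simp] theorem ofLE_E (pE : SAPseudoexpectation n D) (h : d ≤ D) : (pE.ofLE h).E = pE.E := rfl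

end SAPseudoexpectation

/-- **More rounds achieve at least as much**: if `d` rounds of Sherali–Adams achieve a
`(c,s)`-approximation on `n`-variable instances then so do `D ≥ d` rounds.
[cite: ChanEtAl2016, §2.1 (arXiv v3 p. 8)] -/
theorem SAAchieves.of_le {k n d D : ℕ} {P : Set ((Fin k → Bool) → Bool)} {c s : ℝ}
    (h : SAAchieves (n := n) P d c s) (hdD : d ≤ D) : SAAchieves (n := n) P D c s :=
  fun I hI pE => h I hI (pE.ofLE hdD)

/-- Contrapositive of `SAAchieves.of_le`: a Sherali–Adams gap after `D` rounds is a gap after every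
`d ≤ D` rounds. [cite: ChanEtAl2016, §2.1 (arXiv v3 p. 8)] -/
theorem not_saAchieves_of_le {k n d D : ℕ} {P : Set ((Fin k → Bool) → Bool)} {c s : ℝ}
    (h : ¬ SAAchieves (n := n) P D c s) (hdD : d ≤ D) : ¬ SAAchieves (n := n) P d c s :=
  fun h' => h (h'.of_le hdD)

/-- Raising the completeness parameter preserves achievement: `(c,s)` ⟹ `(c',s)` for `c ≤ c'`.
[cite: ChanEtAl2016, §2 (arXiv v3 p. 6: "(c,s)-approximation")] -/
theorem SAAchieves.mono_c {k n d : ℕ} {P : Set ((Fin k → Bool) → Bool)} {c c' s : ℝ}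
    (h : SAAchieves (n := n) P d c s) (hc : c ≤ c') : SAAchieves (n := n) P d c' s :=
  fun I hI pE => (h I hI pE).trans hc

/-! ### The named facts -/

/-- **Chan–Lee–Raghavendra–Steurer, Theorem 3.1 (Main): polynomial-size LP relaxations of a Max-CSP
are no stronger than `O(1)` rounds of Sherali–Adams.**  For every arity `k`, every positive `d ≥ k`,
every finite family `𝒫` of `k`-ary predicates and all `c, s`: if for some `m` the `d`-round
Sherali–Adams relaxation cannot achieve a `(c,s)`-approximation on `m`-variable instances of Max-`𝒫`,
then there is `n₀` such that for every `n ≥ n₀` no LP relaxation of size `R ≤ n^{d/2}` achieves a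
`(c,s)`-approximation on `n`-variable instances.  (See the module docstring for the reading of the
printed "for every `n`".)  NOT proved in this file. [cite: ChanEtAl2016, Thm 3.1 (arXiv v3 p. 9)] -/
def ChanEtAl2016_thm31 : Prop :=
  ∀ (k d : ℕ) (P : Set ((Fin k → Bool) → Bool)) (c s : ℝ), 1 ≤ d → k ≤ d →
    ∀ m : ℕ, ¬ SAAchieves (n := m) P d c s →
      ∃ n₀ : ℕ, ∀ n : ℕ, n₀ ≤ n → ∀ R : ℕ, (R : ℝ) ≤ (n : ℝ) ^ ((d : ℝ) / 2) →
        ∀ L : LPRelaxation k n P R, ¬ L.Achieves c s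

/-- **Chan–Lee–Raghavendra–Steurer, Theorem 3.2 (growing number of rounds).**  For every arity `k`,
family `𝒫`, all `c, s`, every margin `δ > 0` and every `f : ℕ → ℕ`: if for all large `n` one has
`f(n) ≥ max(1,k)` and the `f(n)`-round Sherali–Adams relaxation cannot achieve a
`(c + δ, s)`-approximation on `n`-variable instances of Max-`𝒫`, then for all sufficiently large `n`
there is `N ≤ n^{10 f(n)}` such that no LP relaxation of size `R ≤ n^{f(n)²}` achieves a
`(c,s)`-approximation on `N`-variable instances.  (Margin `δ`: see the module docstring, RENDERING
(ii).)  NOT proved in this file. [cite: ChanEtAl2016, Thm 3.2 (arXiv v3 p. 9; proof p. 11)] -/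
def ChanEtAl2016_thm32 : Prop :=
  ∀ (k : ℕ) (P : Set ((Fin k → Bool) → Bool)) (c s δ : ℝ) (f : ℕ → ℕ), 0 < δ →
    (∃ n₁ : ℕ, ∀ n : ℕ, n₁ ≤ n → 1 ≤ f n ∧ k ≤ f n ∧ ¬ SAAchieves (n := n) P (f n) (c + δ) s) →
    ∃ n₀ : ℕ, ∀ n : ℕ, n₀ ≤ n → ∃ N : ℕ, N ≤ n ^ (10 * f n) ∧
      ∀ R : ℕ, (R : ℝ) ≤ (n : ℝ) ^ ((f n : ℝ) ^ 2) →
        ∀ L : LPRelaxation k N P R, ¬ L.Achieves c s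

/-! ### How the facts are consumed -/

/-- **Polynomial-size LPs do not beat linear-round Sherali–Adams gaps (Thm 3.1 applied to a gap of the
[Schoenebeck08]/[CMM09] shape).**  Under `ChanEtAl2016_thm31`: if for every `ε > 0` the
`⌊c_ε n⌋`-round Sherali–Adams relaxation of Max-`𝒫` fails to `(1 − ε, s₀ + ε)`-approximate for all
large `n` (the shape of the tree's PROVED `Schoenebeck2008_maxKSatSA`, `Schoenebeck2008_maxKXorSA`,
`Schoenebeck2008_parityImplied_SA`), then for every `ε > 0` and every `d ≥ max(1,k)` there is `n₀` with:
for all `n ≥ n₀`, no LP relaxation of size `R ≤ n^{d/2}` achieves a `(1 − ε, s₀ + ε)`-approximation on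
`n`-variable instances ("any polynomial-sized linear program for Max 3-Sat has an integrality gap of
7/8", abstract p. 1, once fed `Schoenebeck2008_maxKSatSA` at `k = 3`).
[cite: ChanEtAl2016, Thm 3.1 (arXiv v3 p. 9) with §3 (p. 9: "known Sherali–Adams gaps … imply the same integrality gaps for LPs")] -/
theorem ChanEtAl2016_thm31.poly_of_linearSAGap (h31 : ChanEtAl2016_thm31) {k : ℕ}
    (P : Set ((Fin k → Bool) → Bool)) {s₀ : ℝ}
    (hSAgap : ∀ ε : ℝ, 0 < ε → ∃ cε : ℝ, 0 < cε ∧ ∃ n₀ : ℕ, ∀ n : ℕ, n₀ ≤ n →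
      ¬ SAAchieves (n := n) P ⌊cε * n⌋₊ (1 - ε) (s₀ + ε))
    {ε : ℝ} (hε : 0 < ε) {d : ℕ} (hd : 1 ≤ d) (hkd : k ≤ d) :
    ∃ n₀ : ℕ, ∀ n : ℕ, n₀ ≤ n → ∀ R : ℕ, (R : ℝ) ≤ (n : ℝ) ^ ((d : ℝ) / 2) →
      ∀ L : LPRelaxation k n P R, ¬ L.Achieves (1 - ε) (s₀ + ε) := by
  obtain ⟨cε, hcε, n₁, H⟩ := hSAgap ε hε
  -- an instance size `m` with `⌊c_ε m⌋ ≥ d` rounds failing, hence `d` rounds failing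
  set m : ℕ := max n₁ ⌈(d : ℝ) / cε⌉₊ with hm
  have hm₁ : n₁ ≤ m := le_max_left _ _
  have hdm : d ≤ ⌊cε * m⌋₊ := by
    refine Nat.le_floor ?_
    have h1 : (d : ℝ) / cε ≤ ⌈(d : ℝ) / cε⌉₊ := Nat.le_ceil _
    have h2 : (⌈(d : ℝ) / cε⌉₊ : ℝ) ≤ m := by
      rw [hm]; exact_mod_cast le_max_right _ _
    calc (d : ℝ) = cε * ((d : ℝ) / cε) := by field_simp
      _ ≤ cε * m := by gcongr; exact h1.trans h2
  exact h31 k d P (1 - ε) (s₀ + ε) hd hkd m (not_saAchieves_of_le (H m hm₁) hdm)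

end Literature.Combinatorics.Optimization

end
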